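import Summits.Ventures.DiscreteObjects.UnitDistance.TwoAdicFrames

/-!
# Ramified step frames (`g₂² = −3`): every step has residue one, so the graph is bipartite
(cell `pub-namedobj`, target (U), seat udg g11)

Framing (verbatim for the cell): lottery ticket; floor = certified bounds/negative ranges.

Continuation of `TwoAdicFrames` (local core of U2-COMPLETE).  THE RAMIFIED CASE `c₂ = −3` of a step frame
(`g₂ = ±I·s3`, i.e. `[5] = [−3]` is a 2-adic square class of the coordinate field `L = ℚ₂(g₁, g₂)`, so that `L(i)/L`
is ramified and conjugation acts trivially on the residue field): `θ = (1 + g₂)/2` is an `α`-fixed unit with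
`θ² = θ − 1`, hence `θ̄` is a primitive cube root of unity; the cube roots of unity of the residue DOMAIN are exactly
`1, θ̄, θ̄²` (`Frame.eq_of_cube_eq_one`), and a step `u` with `ū = θ̄` (resp. `θ̄²`) would give `1 = u·αu ≡ θ²`
(resp. `θ⁴`) modulo the maximal ideal, i.e. `θ̄ = 0` (resp. `θ̄ = 1`) — so `ū = 1` for EVERY frame step
(`Frame.resid_step_eq_one`) and every graph labelled with frame-step differences is BIPARTITE (`Frame.colorable_two`).
Kernel form of PROP-U2.md §(c) (udg g3, refereed on paper): 'ramified ⇒ Cay(k, ρ(U)) ⊆ Cay(k, {1}) is a perfect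
matching'.  No residue field is named; nothing here is literature.
-/

noncomputable section

namespace Summit.Ventures.DiscreteObjects.UnitDistance.MoserLocal

open Spectral SimpleGraph

variable {Ω : Type*} [Field Ω] [CharZero Ω] [Algebra ℚ_[2] Ω] [Algebra.IsAlgebraic ℚ_[2] Ω]
variable {D : LocalData23 Ω} (F : D.Frame)

section Ramified

variable (h3 : F.c₂ = -3)
include h3

omit [CharZero Ω] [Algebra.IsAlgebraic ℚ_[2] Ω] in
/-- In a ramified frame `g₂² = −3`. -/
theorem LocalData23.Frame.g₂_sq_eq_neg_three : F.g₂ ^ 2 = -3 := by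
  rw [F.g₂_sq, h3, map_neg, map_ofNat]

/-- The sixth root of unity `θ = (1 + g₂)/2` of a ramified frame. -/
def LocalData23.Frame.theta : Ω := (1 + F.g₂) / 2

omit [Algebra.IsAlgebraic ℚ_[2] Ω] in
/-- `θ² = θ − 1`. -/
theorem LocalData23.Frame.theta_sq : F.theta ^ 2 = F.theta - 1 := by
  have h := F.g₂_sq_eq_neg_three h3
  rw [LocalData23.Frame.theta]
  field_simp
  linear_combination h

omit [Algebra.IsAlgebraic ℚ_[2] Ω] in
/-- `θ · (1 − θ) = 1` (so `θ` is a unit of the unit ball). -/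
theorem LocalData23.Frame.theta_mul : F.theta * (1 - F.theta) = 1 := by
  linear_combination (-1 : Ω) * F.theta_sq h3

omit [CharZero Ω] [Algebra.IsAlgebraic ℚ_[2] Ω] h3 in
/-- `α θ = θ`. -/
theorem LocalData23.Frame.α_theta : F.α F.theta = F.theta := by
  rw [LocalData23.Frame.theta, map_div₀, map_add, map_one, map_ofNat, F.αg₂]

/-- `‖θ‖ = 1`. -/
theorem LocalData23.Frame.spN_theta : spN ℚ_[2] F.theta = 1 := by
  have hprod := congrArg (spN ℚ_[2]) (F.theta_mul h3)
  rw [spN_mul, spN_one] at hprod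
  -- `‖θ‖ ≤ 1`: otherwise `‖1 − θ‖ = ‖θ‖` and the product has norm `> 1`
  have hle : spN ℚ_[2] F.theta ≤ 1 := by
    by_contra hgt
    push Not at hgt
    have hne : spN ℚ_[2] (1 : Ω) ≠ spN ℚ_[2] (-F.theta) := by
      rw [spN_one, spN_neg]; exact ne_of_lt hgt
    have h1 : spN ℚ_[2] (1 - F.theta) = spN ℚ_[2] F.theta := by
      rw [sub_eq_add_neg, spN_add_eq_max_of_ne ℚ_[2] hne, spN_one, spN_neg, max_eq_right hgt.le]
    rw [h1] at hprod
    nlinarith [hprod, hgt]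
  have hle' : spN ℚ_[2] (1 - F.theta) ≤ 1 := by
    calc spN ℚ_[2] (1 - F.theta) ≤ max (spN ℚ_[2] (1 : Ω)) (spN ℚ_[2] F.theta) := spN_sub_le ℚ_[2] _ _
      _ ≤ 1 := by rw [spN_one]; exact max_le le_rfl hle
  have h0 := spN_nonneg ℚ_[2] (1 - F.theta)
  have h0' := spN_nonneg ℚ_[2] F.theta
  nlinarith [hprod, hle, hle', h0, h0']

/-- `θ` lies in the unit ball. -/
theorem LocalData23.Frame.theta_mem_ball : F.theta ∈ ball ℚ_[2] Ω := by
  rw [mem_ball_iff, F.spN_theta h3]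

/-- `θ` as an element of the unit ball. -/
def LocalData23.Frame.thetaB : ball ℚ_[2] Ω := ⟨F.theta, F.theta_mem_ball h3⟩

/-- `θ̄² = θ̄ + 1` (characteristic `2`). -/
theorem LocalData23.Frame.resid_theta_sq :
    resid ℚ_[2] Ω (F.thetaB h3) ^ 2 = resid ℚ_[2] Ω (F.thetaB h3) + 1 := by
  have h : (F.thetaB h3) ^ 2 = F.thetaB h3 - 1 := by
    apply Subtype.ext
    change F.theta ^ 2 = F.theta - 1
    exact F.theta_sq h3
  have := congrArg (resid ℚ_[2] Ω) h
  rw [map_pow, map_sub, map_one] at this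
  rw [this, sub_eq_add_neg, neg_eq_self_resid]

/-- `θ̄ ≠ 0`. -/
theorem LocalData23.Frame.resid_theta_ne_zero : resid ℚ_[2] Ω (F.thetaB h3) ≠ 0 :=
  resid_ne_zero_of_spN_eq_one ℚ_[2] (F.spN_theta h3)

/-- `θ̄ ≠ 1` (`1 + 1 + 1 ≠ 0` in characteristic `2`). -/
theorem LocalData23.Frame.resid_theta_ne_one : resid ℚ_[2] Ω (F.thetaB h3) ≠ 1 := by
  intro h1
  have h := F.resid_theta_sq h3
  rw [h1, one_pow] at h
  -- 1 = 1 + 1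
  have : (1 : Resid ℚ_[2] Ω) = 0 := by
    have h2 : (1 : Resid ℚ_[2] Ω) + 1 = 0 := by rw [← two_mul, mul_one]; exact two_eq_zero_resid
    calc (1 : Resid ℚ_[2] Ω) = 1 + 1 := h
      _ = 0 := h2
  exact one_ne_zero this

/-- `θ̄³ = 1`. -/
theorem LocalData23.Frame.resid_theta_cube : resid ℚ_[2] Ω (F.thetaB h3) ^ 3 = 1 := by
  set t := resid ℚ_[2] Ω (F.thetaB h3) with ht
  have h := F.resid_theta_sq h3
  have h11 : (1 : Resid ℚ_[2] Ω) + 1 = 0 := by rw [← two_mul, mul_one]; exact two_eq_zero_resid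
  calc t ^ 3 = t * t ^ 2 := by ring
    _ = t * (t + 1) := by rw [h]
    _ = t ^ 2 + t := by ring
    _ = (t + 1) + t := by rw [h]
    _ = t * 2 + 1 := by ring
    _ = 1 := by rw [two_eq_zero_resid, mul_zero, zero_add]

/-- THE CUBE ROOTS OF UNITY of the residue domain are `1, θ̄, θ̄²`. -/
theorem LocalData23.Frame.eq_of_cube_eq_one {x : Resid ℚ_[2] Ω} (hx : x ^ 3 = 1) :
    x = 1 ∨ x = resid ℚ_[2] Ω (F.thetaB h3) ∨ x = resid ℚ_[2] Ω (F.thetaB h3) ^ 2 := by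
  set t := resid ℚ_[2] Ω (F.thetaB h3) with ht
  have h := F.resid_theta_sq h3
  have h3t := F.resid_theta_cube h3
  -- x³ - 1 = (x - 1)(x - t)(x - t²)
  have hfac : (x - 1) * ((x - t) * (x - t ^ 2)) = 0 := by
    have e1 : (x - t) * (x - t ^ 2) = x ^ 2 - (t + t ^ 2) * x + t ^ 3 := by ring
    have e2 : t + t ^ 2 = 1 := by
      rw [h]
      calc t + (t + 1) = t * 2 + 1 := by ring
        _ = 1 := by rw [two_eq_zero_resid, mul_zero, zero_add]
    rw [e1, e2, h3t, one_mul]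
    have e3 : (x - 1) * (x ^ 2 - x + 1) = (x ^ 3 - 1) - (x ^ 2 - x) * 2 := by ring
    rw [e3, hx, two_eq_zero_resid, mul_zero, sub_zero, sub_self]
  rcases mul_eq_zero.1 hfac with h1 | h23
  · left; exact sub_eq_zero.1 h1
  · rcases mul_eq_zero.1 h23 with h2 | h3'
    · right; left; exact sub_eq_zero.1 h2
    · right; right; exact sub_eq_zero.1 h3'

omit [CharZero Ω] h3 in
/-- KEY ESTIMATE: a frame step is NOT congruent to an `α`-fixed element `w` with `w̄² ≠ 1`
(else `1 = u·αu ≡ w²`).  Stated for `w = θ` and `w = θ²` below. -/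
theorem LocalData23.Frame.spN_sub_lt_imp {u w : Ω} (hu : u ∈ F.steps) (hαw : F.α w = w) (hw : spN ℚ_[2] w ≤ 1)
    (hlt : spN ℚ_[2] (u - w) < 1) : spN ℚ_[2] (1 - w ^ 2) < 1 := by
  have hprod := F.mul_α_eq_one hu
  have hnu := F.spN_step hu
  have hα : spN ℚ_[2] (F.α u - w) < 1 := by
    have : F.α u - w = F.α (u - w) := by rw [map_sub, hαw]
    rw [this, spN_aut]; exact hlt
  have hid : (1 : Ω) - w ^ 2 = u * (F.α u - w) + w * (u - w) := by rw [← hprod]; ring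
  rw [hid]
  refine (spN_add_le ℚ_[2] _ _).trans_lt (max_lt ?_ ?_)
  · rw [spN_mul, hnu, one_mul]; exact hα
  · rw [spN_mul]
    calc spN ℚ_[2] w * spN ℚ_[2] (u - w) ≤ 1 * spN ℚ_[2] (u - w) :=
          mul_le_mul_of_nonneg_right hw (spN_nonneg ℚ_[2] _)
      _ < 1 := by rw [one_mul]; exact hlt

/-- MAIN LOCAL LEMMA OF THE RAMIFIED CASE: every frame step has residue `1`. -/
theorem LocalData23.Frame.resid_step_eq_one {u : Ω} (hu : u ∈ F.steps) :
    resid ℚ_[2] Ω ⟨u, F.step_mem_ball hu⟩ = 1 := by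
  have hθ1 := F.spN_theta h3
  have h11 : (1 : Resid ℚ_[2] Ω) + 1 = 0 := by rw [← two_mul, mul_one]; exact two_eq_zero_resid
  rcases F.eq_of_cube_eq_one h3 (F.resid_step_cube hu) with h1 | hθ | hθ2
  · exact h1
  · -- `ū = θ̄`: then `‖1 − θ²‖ < 1`, i.e. `θ̄² = 1`, i.e. `θ̄ = 0`
    exfalso
    have hlt : spN ℚ_[2] (u - F.theta) < 1 := by
      have := (resid_eq_iff ℚ_[2] ⟨u, F.step_mem_ball hu⟩ (F.thetaB h3)).1 hθ
      exact this
    have h := F.spN_sub_lt_imp hu F.α_theta hθ1.le hlt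
    have hmem : (1 : Ω) - F.theta ^ 2 ∈ ball ℚ_[2] Ω := le_of_lt h
    have hres : resid ℚ_[2] Ω ⟨1 - F.theta ^ 2, hmem⟩ = 0 := (resid_eq_zero_iff ℚ_[2] _).2 h
    have : (⟨1 - F.theta ^ 2, hmem⟩ : ball ℚ_[2] Ω) = 1 - (F.thetaB h3) ^ 2 := Subtype.ext rfl
    rw [this, map_sub, map_one, map_pow, F.resid_theta_sq h3, sub_eq_zero] at hres
    -- hres : 1 = θ̄ + 1
    have : resid ℚ_[2] Ω (F.thetaB h3) = 0 := by
      calc resid ℚ_[2] Ω (F.thetaB h3) = (resid ℚ_[2] Ω (F.thetaB h3) + 1) + 1 := by rw [add_assoc, h11, add_zero]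
        _ = 1 + 1 := by rw [← hres]
        _ = 0 := h11
    exact F.resid_theta_ne_zero h3 this
  · -- `ū = θ̄²`: then `‖1 − θ⁴‖ < 1`, i.e. `θ̄⁴ = θ̄ = 1`
    exfalso
    have hθ2mem : F.theta ^ 2 ∈ ball ℚ_[2] Ω := (ball ℚ_[2] Ω).pow_mem (F.theta_mem_ball h3) 2
    have hb : (F.thetaB h3) ^ 2 = ⟨F.theta ^ 2, hθ2mem⟩ := Subtype.ext rfl
    have hlt : spN ℚ_[2] (u - F.theta ^ 2) < 1 := by
      rw [← map_pow, hb] at hθ2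
      exact (resid_eq_iff ℚ_[2] ⟨u, F.step_mem_ball hu⟩ ⟨F.theta ^ 2, hθ2mem⟩).1 hθ2
    have hα2 : F.α (F.theta ^ 2) = F.theta ^ 2 := by rw [map_pow, F.α_theta]
    have hn2 : spN ℚ_[2] (F.theta ^ 2) ≤ 1 := by rw [spN_pow, hθ1, one_pow]
    have h := F.spN_sub_lt_imp hu hα2 hn2 hlt
    have hmem : (1 : Ω) - (F.theta ^ 2) ^ 2 ∈ ball ℚ_[2] Ω := le_of_lt h
    have hres : resid ℚ_[2] Ω ⟨1 - (F.theta ^ 2) ^ 2, hmem⟩ = 0 := (resid_eq_zero_iff ℚ_[2] _).2 h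
    have : (⟨1 - (F.theta ^ 2) ^ 2, hmem⟩ : ball ℚ_[2] Ω) = 1 - ((F.thetaB h3) ^ 2) ^ 2 := Subtype.ext rfl
    rw [this, map_sub, map_one, map_pow, map_pow, F.resid_theta_sq h3, sub_eq_zero] at hres
    -- hres : 1 = (θ̄ + 1)²  = θ̄² + 1 = θ̄ + 1 + 1 = θ̄
    have hsq : (resid ℚ_[2] Ω (F.thetaB h3) + 1) ^ 2 = resid ℚ_[2] Ω (F.thetaB h3) := by
      rw [add_sq_resid, one_pow, F.resid_theta_sq h3, add_assoc, h11, add_zero]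
    rw [hsq] at hres
    exact F.resid_theta_ne_one h3 hres.symm

/-- TWO COLOURS in a ramified frame: labels with frame-step differences give a BIPARTITE graph. -/
theorem LocalData23.Frame.colorable_two {V : Type*} {G : SimpleGraph V} (z : V → Ω)
    (hz : ∀ ⦃v w : V⦄, G.Adj v w → z v - z w ∈ F.steps) : G.Colorable 2 :=
  colorable_two_of_one_steps F.steps (fun _ hu => F.spN_step hu) (fun _ hu => F.resid_step_eq_one h3 hu) z hz

end Ramified

end Summit.Ventures.DiscreteObjects.UnitDistance.MoserLocal
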